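import Literature.Topology.FourManifolds.SphereBallTransfer
import Literature.Topology.FourManifolds.HCobordismPartialProduct
import Literature.Topology.FourManifolds.SPC4Wave0
import HarnessLib

/-!
# A small exotic `ℝ⁴` from Casson–Freedman and Donaldson (Kirby's Theorem XIV.3): the bridge

Topic `Literature/Topology/FourManifolds`. This file PROVES the assembly step of the classical
existence proof of an exotic `ℝ⁴` inside `S⁴` — R. C. Kirby, *The Topology of 4-Manifolds*,
LNM 1374 (1989), Ch. XIV, Theorem 3 ("Casson and Freedman: There exists an exotic `ℝ⁴_Θ` which
imbeds smoothly in `S⁴`"), proof pp. 98–101 — relative to its two deep inputs, which enter as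
HYPOTHESES (the end data `P : PartialProductEnds X₀ X₁` of a pair of smooth 4-manifolds, and
`IsEmpty (X₀ ≃ₘ X₁)`):

* (A) Donaldson 1987: the pair — in the source `X₀ = L(2,3)` (Dolgachev surface),
  `X₁ = CP² ♯ 9(−CP²)` — is smoothly h-cobordant and not diffeomorphic (Kirby p. 98; abstractly
  the tree's fact `Literature.Topology.FourManifolds.exists_isHCobordant_isEmpty_diffeomorph_four`,
  `HCobordism.lean`, spc4.S16);
* (B) the Casson–Freedman partial smooth product structure of the h-cobordism between them
  leaves the end data `PartialProductEnds X₀ X₁` (`HCobordismPartialProduct.lean`; Kirby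
  pp. 99–101; for an arbitrary simply connected h-cobordism, without the `S⁴ × I` clause,
  De Michelis–Freedman 1992, Thm. 3.1; both resting on Freedman 1982, Thm. 1.1).

(B) is not vendored as a named fact (D-0026 reviews of the decomposition, 2026-08-15): earlier
revisions took it from the named facts `cassonFreedman_partialProductEnds` (universal: every
smoothly h-cobordant simply connected closed pair carries the data) and
`kirby1989_partialProductEnds` ((A) ∧ (B) for one pair) of `HCobordismPartialProduct.lean`; both
were merged back — they are theories, not M-sized facts (Freedman's Thm. 1.1 and Casson's
imbedding theorem, whose objects the tree cannot yet define), and the `S⁴`-compatibility clause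
of the universal form is printed only inside Kirby's proof for his one h-cobordism
(De Michelis–Freedman, p. 239, cite "[14, p. 101]" for it). What Kirby prints for his ONE pair
is exactly the unbundled hypothesis shape `P`, `hE` of the theorems below — fully proved
theorems with no named fact in their trust base, into which a future construction of the end
data (for Donaldson's pair, whose existence is the fact spc4.S16, or for every simply connected
h-cobordism) plugs directly.

Results:

* `PartialProductEnds.nonempty_diffeomorph` — **Kirby's regluing argument (p. 101), proved**: if
  every open subset of `ℝ⁴` homeomorphic to `ℝ⁴` is diffeomorphic to `ℝ⁴`, then two 4-manifolds
  carrying the end data `PartialProductEnds X₀ X₁` are diffeomorphic.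
* `PartialProductEnds.exists_opens_nonempty_homeomorph_isEmpty_diffeomorph_euclideanSpace_four`
  (from the end data of one non-diffeomorphic pair, unbundled) — **spc4.S11**
  (`Literature.Topology.FourManifolds.exists_opens_nonempty_homeomorph_isEmpty_diffeomorph_euclideanSpace_four`,
  Mathlib's `proof_wanted exists_open_nonempty_homeomorph_isEmpty_diffeomorph_euclideanSpace_four`:
  an open subset of `ℝ⁴` homeomorphic but not diffeomorphic to `ℝ⁴`). Hence also the barrier
  `Literature.Barriers.SmoothPoincare4.OpenAnalogueBarrierFour`
  (`Barriers/SmoothPoincare4/ExoticOpenFourSpaceKirbyProofs.lean`).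

## The proof of `PartialProductEnds.nonempty_diffeomorph` (Kirby p. 101, collars matched)

Data: `Z₀ ⊆ X₀` open, `≈ ℝ⁴`, `K₀ ⊆ Z₀` compact, `ψ : X₀ ∖ K₀ ≅ X₁ ∖ K₁` with
`ψ (Z₀ ∖ K₀) = Z₁ ∖ K₁`, `jᵢ : Zᵢ ↪ S⁴`, `Ψ : S⁴ ∖ j₀ K₀ ≅ S⁴ ∖ j₁ K₁` with `Ψ ∘ j₀ = j₁ ∘ ψ`.
1. `j₀ Z₀ ≠ S⁴` (`ℝ⁴` is not compact); a stereographic chart from a missed point identifies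
   `j₀ Z₀` with an open `U₀ ⊆ ℝ⁴`, `U₀ ≈ ℝ⁴`, so by HYPOTHESIS `U₀ ≅ ℝ⁴`: a partial diffeomorphism
   `c₀ : ℝ⁴ ≅ Z₀`, rescaled so that `K₀ ⊆ c₀ (B(0, 1/8))`.
2. `e := j₀ ∘ c₀ : ℝ⁴ ↪ S⁴` and `Ψ` is defined off `e (B(0, 1/8))`; `exists_transferredBall`
   (`SphereBallTransfer.lean`: Palais' disc theorem twice + uniqueness of collars) gives `ρ > 1`
   and `b : ℝ⁴ ↪ S⁴` with `b(𝔻⁴) = S⁴ ∖ Ψ (S⁴ ∖ e(𝔻⁴)) ⊆ j₁ Z₁` and `b = Ψ ∘ e = j₁ ∘ ψ ∘ c₀` on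
   `{1 ≤ ‖y‖ < ρ}` — "`ρS³ × 1` bounds a smooth 4-ball [...] in `Z₁`", with its collar MATCHED,
   which replaces Kirby's "since all diffeomorphisms of `S³` extend over `B⁴`" (Cerf).
3. `b₁ := j₁⁻¹ ∘ b` on `B(0, ρ)`; `F := ψ` off `c₀(𝔻⁴)` and `:= b₁ ∘ c₀⁻¹` on `c₀(B(0, ρ))` is
   well defined (the two agree on the collar), smooth, bijective with smooth inverse
   `G := ψ⁻¹` off `b₁(𝔻⁴)`, `:= c₀ ∘ b₁⁻¹` on `b₁(B(0, ρ))`: `X₀ ≅ X₁`.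

## References

* R. C. Kirby, *The Topology of 4-Manifolds*, LNM 1374 (1989), Ch. XIV, Thm. 3, proof
  pp. 98–101. [Kirby1989]
* S. De Michelis, M. H. Freedman, J. Differential Geom. 35 (1992), Thm. 3.1 and p. 239 ("The
  original argument [...] used only the fact that the manifold at the ends of the h-cobordism
  were different [...] well described in [14, p. 101]"). [DeMichelisFreedman1992]
* S. K. Donaldson, J. Differential Geom. 26 (1987), p. 142. [DonaldsonIrrationality1987]
-/

open scoped Manifold ContDiff Topology
open Function Set Metric Module

noncomputable section

namespace Literature.Topology.FourManifolds

/-! ### The bridge: Kirby's regluing argument -/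

section Bridge

variable {X₀ X₁ : Type} [TopologicalSpace X₀] [T2Space X₀] [ChartedSpace (EuclideanSpace ℝ (Fin 4)) X₀]
  [TopologicalSpace X₁] [T2Space X₁] [ChartedSpace (EuclideanSpace ℝ (Fin 4)) X₁]

/-- **Kirby's regluing argument** (Kirby 1989, Ch. XIV, proof of Thm. 3, p. 101). Suppose every
open subset of `ℝ⁴` homeomorphic to `ℝ⁴` is diffeomorphic to `ℝ⁴`. Then two 4-manifolds carrying
the end data `PartialProductEnds X₀ X₁` of a partial smooth product structure (an open
`ℝ⁴`-homeomorph `Z₀ ⊆ X₀` embedded in `S⁴`, a diffeomorphism `ψ : X₀ ∖ K₀ ≅ X₁ ∖ K₁` and a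
compatible diffeomorphism `Ψ` of `S⁴ ∖ j₀ K₀`) are diffeomorphic: `Z₀ ≅ ℝ⁴` (hypothesis, via a
stereographic chart), so `K₀` lies in a smooth ball `c₀(𝔻⁴) ⊆ Z₀`; the inside
`S⁴ ∖ Ψ (S⁴ ∖ j₀ c₀ (𝔻⁴))` is a smooth ball `b(𝔻⁴) ⊆ j₁ Z₁` whose collar is `Ψ ∘ j₀ ∘ c₀ = j₁ ∘ ψ ∘ c₀`
(`exists_transferredBall`: Palais twice plus uniqueness of collars — replacing Kirby's appeal to
"all diffeomorphisms of `S³` extend over `B⁴`"); and `ψ` off `c₀(𝔻⁴)` glued with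
`j₁⁻¹ ∘ b ∘ c₀⁻¹` on `c₀(B(0, ρ))` is a diffeomorphism `X₀ ≅ X₁`.
[cite: Kirby1989, Ch. XIV Thm. 3 (proof p. 101)] -/
theorem PartialProductEnds.nonempty_diffeomorph
    (hU : ∀ U : TopologicalSpace.Opens (EuclideanSpace ℝ (Fin 4)), Nonempty (U ≃ₜ EuclideanSpace ℝ (Fin 4)) →
      Nonempty (U ≃ₘ⟮𝓡 4, 𝓡 4⟯ EuclideanSpace ℝ (Fin 4)))
    (P : PartialProductEnds X₀ X₁) : Nonempty (X₀ ≃ₘ⟮𝓡 4, 𝓡 4⟯ X₁) := by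
  classical
  haveI : Fact (finrank ℝ (EuclideanSpace ℝ (Fin (4 + 1))) = 4 + 1) := ⟨finrank_euclideanSpace_fin⟩
  /- S1: a parametrisation `c₁ : ℝ⁴ ≅ Z₀` -/
  have hZ₀src : P.j₀.source = P.Z₀ := P.j₀_source
  obtain ⟨φZ⟩ := P.nonempty_homeomorph_Z₀
  obtain ⟨p, hp⟩ : ∃ p : Metric.sphere (0 : EuclideanSpace ℝ (Fin (4 + 1))) 1, p ∉ P.j₀.target := by
    by_contra hall
    push Not at hall
    have htgt : P.j₀.target = univ := eq_univ_of_forall hall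
    have e1 : (Metric.sphere (0 : EuclideanSpace ℝ (Fin (4 + 1))) 1) ≃ₜ EuclideanSpace ℝ (Fin 4) :=
      (Homeomorph.Set.univ (Metric.sphere (0 : EuclideanSpace ℝ (Fin (4 + 1))) 1)).symm.trans <| (Homeomorph.setCongr htgt).symm.trans <|
        P.j₀.toHomeomorphSourceTarget.symm.trans <| (Homeomorph.setCongr hZ₀src).trans φZ
    haveI : CompactSpace (EuclideanSpace ℝ (Fin 4)) := e1.compactSpace
    exact not_compactSpace_iff.2 (inferInstance : NoncompactSpace (EuclideanSpace ℝ (Fin 4))) inferInstance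
  set σ := chartAt (EuclideanSpace ℝ (Fin 4)) (-p) with hσ
  have hσsrc : σ.source = {p}ᶜ := by
    rw [hσ]
    show (stereographic' 4 (-(-p))).source = {p}ᶜ
    rw [neg_neg, stereographic'_source]
  have hσc : ContMDiffOn (𝓡 4) (𝓡 4) ∞ σ σ.source := contMDiffOn_chart
  have hσc' : ContMDiffOn (𝓡 4) (𝓡 4) ∞ σ.symm σ.target := contMDiffOn_chart_symm
  set T := P.j₀.trans σ with hT
  have hTsrc : T.source = P.Z₀ := by
    rw [hT, OpenPartialHomeomorph.trans_source, hZ₀src, hσsrc]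
    refine inter_eq_left.2 fun x hx hxp ↦ hp ?_
    rw [mem_singleton_iff] at hxp
    rw [← hxp]; exact P.j₀.map_source (by rw [hZ₀src]; exact hx)
  have hTc : ContMDiffOn (𝓡 4) (𝓡 4) ∞ T T.source :=
    OpenPartialHomeomorph.contMDiffOn_trans_source P.contMDiffOn_j₀ hσc
  have hTc' : ContMDiffOn (𝓡 4) (𝓡 4) ∞ T.symm T.target :=
    OpenPartialHomeomorph.contMDiffOn_trans_symm_target P.contMDiffOn_j₀_symm hσc'
  let U₀ : TopologicalSpace.Opens (EuclideanSpace ℝ (Fin 4)) := ⟨T.target, T.open_target⟩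
  have hU₀ : Nonempty (U₀ ≃ₜ EuclideanSpace ℝ (Fin 4)) :=
    ⟨T.toHomeomorphSourceTarget.symm.trans ((Homeomorph.setCongr hTsrc).trans φZ)⟩
  obtain ⟨φ₀⟩ := hU U₀ hU₀
  -- `c₁ := T⁻¹ ∘ φ₀⁻¹ : ℝ⁴ → Z₀`
  set c₁ := (Diffeomorph.toOpenPartialHomeomorphOpens φ₀.symm).trans T.symm with hc₁
  have hc₁src : c₁.source = univ := by
    rw [hc₁, OpenPartialHomeomorph.trans_source, Diffeomorph.toOpenPartialHomeomorphOpens_source,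
      univ_inter, OpenPartialHomeomorph.symm_source]
    refine eq_univ_of_forall fun y ↦ ?_
    show (Diffeomorph.toOpenPartialHomeomorphOpens φ₀.symm) y ∈ T.target
    have := (Diffeomorph.toOpenPartialHomeomorphOpens φ₀.symm).map_source (x := y)
      (by rw [Diffeomorph.toOpenPartialHomeomorphOpens_source]; exact mem_univ y)
    rwa [Diffeomorph.toOpenPartialHomeomorphOpens_target] at this
  have hc₁tgt : c₁.target = P.Z₀ := by
    rw [hc₁, OpenPartialHomeomorph.trans_target, OpenPartialHomeomorph.symm_target,
      OpenPartialHomeomorph.symm_symm, Diffeomorph.toOpenPartialHomeomorphOpens_target, hTsrc]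
    refine inter_eq_left.2 fun x hx ↦ ?_
    show T x ∈ (U₀ : Set (EuclideanSpace ℝ (Fin 4)))
    exact T.map_source (by rw [hTsrc]; exact hx)
  have hc₁c : ContMDiffOn (𝓡 4) (𝓡 4) ∞ c₁ c₁.source :=
    OpenPartialHomeomorph.contMDiffOn_trans_source
      (Diffeomorph.contMDiffOn_toOpenPartialHomeomorphOpens φ₀.symm)
      (by rw [← OpenPartialHomeomorph.symm_source] at hTc'; exact hTc')
  have hc₁c' : ContMDiffOn (𝓡 4) (𝓡 4) ∞ c₁.symm c₁.target :=
    OpenPartialHomeomorph.contMDiffOn_trans_symm_target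
      (Diffeomorph.contMDiffOn_toOpenPartialHomeomorphOpens_symm φ₀.symm)
      (by rw [OpenPartialHomeomorph.symm_symm, OpenPartialHomeomorph.symm_target]; exact hTc)
  /- S2: rescale so that `K₀ ⊆ c₀ (B(0, 1/8))` -/
  have hK₀' : IsCompact (c₁.symm '' P.K₀) :=
    P.isCompact_K₀.image_of_continuousOn (c₁.continuousOn_symm.mono
      (by rw [hc₁tgt]; exact P.K₀_subset))
  obtain ⟨R, hR⟩ := hK₀'.isBounded.subset_ball 0
  set R' : ℝ := max R 1 with hR'
  have hR'pos : 0 < R' := lt_of_lt_of_le one_pos (le_max_right _ _)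
  have h8R' : (8 * R' : ℝ) ≠ 0 := by positivity
  set μ := (Homeomorph.smulOfNeZero (8 * R') h8R').toOpenPartialHomeomorph
      (X := EuclideanSpace ℝ (Fin 4)) with hμ
  have hμcoe : ∀ y : EuclideanSpace ℝ (Fin 4), μ y = (8 * R') • y := fun _ ↦ rfl
  have hμsymm : ∀ y : EuclideanSpace ℝ (Fin 4), μ.symm y = (8 * R')⁻¹ • y := fun _ ↦ rfl
  have hμc : ContMDiffOn (𝓡 4) (𝓡 4) ∞ μ μ.source :=
    ((contDiff_const_smul (8 * R')).contMDiff (n := ∞)).contMDiffOn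
  have hμc' : ContMDiffOn (𝓡 4) (𝓡 4) ∞ μ.symm μ.target :=
    ((contDiff_const_smul (8 * R')⁻¹).contMDiff (n := ∞)).contMDiffOn
  set c₀ := μ.trans c₁ with hc₀
  have hc₀src : c₀.source = univ := by
    rw [hc₀, OpenPartialHomeomorph.trans_source, hc₁src, preimage_univ, inter_univ]; rfl
  have hc₀tgt : c₀.target = P.Z₀ := by
    rw [hc₀, OpenPartialHomeomorph.trans_target, hc₁tgt]
    refine inter_eq_left.2 fun x _ ↦ ?_
    show c₁.symm x ∈ μ.target
    exact mem_univ _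
  have hc₀c : ContMDiffOn (𝓡 4) (𝓡 4) ∞ c₀ c₀.source :=
    OpenPartialHomeomorph.contMDiffOn_trans_source hμc hc₁c
  have hc₀c' : ContMDiffOn (𝓡 4) (𝓡 4) ∞ c₀.symm c₀.target :=
    OpenPartialHomeomorph.contMDiffOn_trans_symm_target hμc' hc₁c'
  have hc₀K : ∀ k ∈ P.K₀, ‖c₀.symm k‖ < 8⁻¹ := by
    intro k hk
    show ‖μ.symm (c₁.symm k)‖ < 8⁻¹
    rw [hμsymm, norm_smul, norm_inv, Real.norm_eq_abs, abs_of_pos (by positivity)]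
    have h1 : ‖c₁.symm k‖ < R := by simpa using hR ⟨k, hk, rfl⟩
    have h2 : ‖c₁.symm k‖ < R' := lt_of_lt_of_le h1 (le_max_left _ _)
    rw [mul_inv, mul_assoc]
    have h3 : R'⁻¹ * ‖c₁.symm k‖ < 1 := by
      rw [inv_mul_lt_iff₀ hR'pos]; linarith
    have : (8:ℝ)⁻¹ * (R'⁻¹ * ‖c₁.symm k‖) < 8⁻¹ * 1 := by
      exact mul_lt_mul_of_pos_left h3 (by norm_num)
    linarith
  -- basic bookkeeping for `c₀`
  have hc₀_mem : ∀ y : EuclideanSpace ℝ (Fin 4), c₀ y ∈ P.Z₀ := fun y ↦ by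
    rw [← hc₀tgt]; exact c₀.map_source (by rw [hc₀src]; exact mem_univ y)
  have hc₀_left : ∀ y : EuclideanSpace ℝ (Fin 4), c₀.symm (c₀ y) = y := fun y ↦
    c₀.left_inv (by rw [hc₀src]; exact mem_univ y)
  have hc₀_right : ∀ x ∈ P.Z₀, c₀ (c₀.symm x) = x := fun x hx ↦
    c₀.right_inv (by rw [hc₀tgt]; exact hx)
  have hc₀_inj : Injective c₀ := by
    rw [← injOn_univ (f := c₀), ← hc₀src]; exact c₀.injOn
  have hc₀_notK : ∀ y : EuclideanSpace ℝ (Fin 4), 8⁻¹ ≤ ‖y‖ → c₀ y ∉ P.K₀ := fun y hy hk ↦ by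
    have := hc₀K _ hk; rw [hc₀_left] at this; linarith
  /- S3–S5: the transferred ball in `S⁴` -/
  set e := c₀.trans P.j₀ with he
  have hesrc : e.source = univ := by
    rw [he, OpenPartialHomeomorph.trans_source, hc₀src, univ_inter, hZ₀src]
    exact eq_univ_of_forall fun y ↦ hc₀_mem y
  have hecoe : ∀ y, e y = P.j₀ (c₀ y) := fun _ ↦ rfl
  have hec : ContMDiffOn (𝓡 4) (𝓡 4) ∞ e e.source :=
    OpenPartialHomeomorph.contMDiffOn_trans_source hc₀c P.contMDiffOn_j₀
  have hec' : ContMDiffOn (𝓡 4) (𝓡 4) ∞ e.symm e.target :=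
    OpenPartialHomeomorph.contMDiffOn_trans_symm_target hc₀c' P.contMDiffOn_j₀_symm
  have hΨe : (e '' ball 0 8⁻¹)ᶜ ⊆ P.Ψ.source := by
    rw [P.Ψ_source]
    refine compl_subset_compl.2 ?_
    rintro _ ⟨k, hk, rfl⟩
    refine ⟨c₀.symm k, mem_ball_zero_iff.2 (hc₀K k hk), ?_⟩
    rw [hecoe, hc₀_right k (P.K₀_subset hk)]
  obtain ⟨ρ, b, hρ, hbsrc, hbc, hbc', hbcol, hbimg⟩ :=
    exists_transferredBall e hesrc hec hec' P.Ψ P.contMDiffOn_Ψ P.contMDiffOn_Ψ_symm hΨe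
  -- the collar of `b` in terms of the data: `b y = j₁ (ψ (c₀ y))` for `1 ≤ ‖y‖ < ρ`
  have hcollar_mem : ∀ y : EuclideanSpace ℝ (Fin 4), 1 ≤ ‖y‖ → c₀ y ∈ P.Z₀ \ P.K₀ := fun y hy ↦
    ⟨hc₀_mem y, hc₀_notK y (by linarith)⟩
  have hψsrc : ∀ y : EuclideanSpace ℝ (Fin 4), 1 ≤ ‖y‖ → c₀ y ∈ P.ψ.source := fun y hy ↦ by
    rw [P.ψ_source]; exact (hcollar_mem y hy).2
  have hψZ₁ : ∀ y : EuclideanSpace ℝ (Fin 4), 1 ≤ ‖y‖ → P.ψ (c₀ y) ∈ P.Z₁ := fun y hy ↦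
    (P.apply_mem_iff _ (hψsrc y hy)).2 (hc₀_mem y)
  have hbcol' : ∀ y : EuclideanSpace ℝ (Fin 4), 1 ≤ ‖y‖ → ‖y‖ < ρ → b y = P.j₁ (P.ψ (c₀ y)) := fun y hy hyρ ↦ by
    rw [hbcol y hy hyρ, hecoe, P.apply_j₀ _ (hcollar_mem y hy)]
  -- the inside ball `I = b (𝔻⁴)` lies in `j₁ Z₁`
  have hZ₁src : P.j₁.source = P.Z₁ := P.j₁_source
  have hcompl_src : (e '' closedBall (0 : EuclideanSpace ℝ (Fin 4)) 1)ᶜ ⊆ P.Ψ.source := fun q hq ↦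
    hΨe fun hq' ↦ hq (image_mono ((ball_subset_ball (by norm_num)).trans ball_subset_closedBall) hq')
  have hI_sub : b '' closedBall 0 1 ⊆ P.j₁.target := by
    rw [hbimg]
    intro q hq
    by_contra hqt
    have hqt' : q ∈ P.Ψ.target := by
      rw [P.Ψ_target]
      rintro ⟨k, hk, rfl⟩
      exact hqt (P.j₁.map_source (by rw [hZ₁src]; exact P.K₁_subset hk))
    set q' := P.Ψ.symm q with hq'
    have hq's : q' ∈ P.Ψ.source := P.Ψ.map_target hqt'
    have hΨq' : P.Ψ q' = q := P.Ψ.right_inv hqt'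
    have h1 : P.Ψ q' ∉ P.j₁ '' P.Z₁ := by
      rw [hΨq']
      rintro ⟨z, hz, rfl⟩
      exact hqt (P.j₁.map_source (by rw [hZ₁src]; exact hz))
    have h2 : q' ∉ P.j₀ '' P.Z₀ := fun h ↦ h1 ((P.apply_mem_image_iff hq's).2 h)
    have h3 : q' ∈ (e '' closedBall (0 : EuclideanSpace ℝ (Fin 4)) 1)ᶜ := by
      rintro ⟨y, -, hy⟩
      exact h2 ⟨c₀ y, hc₀_mem y, by rw [← hy, hecoe]⟩
    exact hq ⟨q', h3, hΨq'⟩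
  have hcol_sub : ∀ y : EuclideanSpace ℝ (Fin 4), 1 ≤ ‖y‖ → ‖y‖ < ρ → b y ∈ P.j₁.target := fun y hy hyρ ↦ by
    rw [hbcol' y hy hyρ]; exact P.j₁.map_source (by rw [hZ₁src]; exact hψZ₁ y hy)
  have hbρ_sub : ∀ y : EuclideanSpace ℝ (Fin 4), ‖y‖ < ρ → b y ∈ P.j₁.target := fun y hyρ ↦ by
    by_cases hy : ‖y‖ ≤ 1
    · exact hI_sub ⟨y, mem_closedBall_zero_iff.2 hy, rfl⟩
    · exact hcol_sub y (by linarith) hyρ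
  /- S6: pull the ball back to `X₁`: `b₁ := j₁⁻¹ ∘ b` on `B(0, ρ)` -/
  set b₁ := b.trans P.j₁.symm with hb₁
  have hb₁coe : ∀ y, b₁ y = P.j₁.symm (b y) := fun _ ↦ rfl
  have hb₁src : ball 0 ρ ⊆ b₁.source := fun y hy ↦ by
    rw [hb₁, OpenPartialHomeomorph.trans_source, hbsrc, univ_inter]
    exact hbρ_sub y (mem_ball_zero_iff.1 hy)
  have hb₁c : ContMDiffOn (𝓡 4) (𝓡 4) ∞ b₁ b₁.source :=
    OpenPartialHomeomorph.contMDiffOn_trans_source hbc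
      (by rw [← OpenPartialHomeomorph.symm_source] at *; exact P.contMDiffOn_j₁_symm)
  have hb₁c' : ContMDiffOn (𝓡 4) (𝓡 4) ∞ b₁.symm b₁.target :=
    OpenPartialHomeomorph.contMDiffOn_trans_symm_target hbc'
      (by rw [OpenPartialHomeomorph.symm_symm, OpenPartialHomeomorph.symm_target]
          exact P.contMDiffOn_j₁)
  have hb₁col : ∀ y : EuclideanSpace ℝ (Fin 4), 1 ≤ ‖y‖ → ‖y‖ < ρ → b₁ y = P.ψ (c₀ y) := fun y hy hyρ ↦ by
    rw [hb₁coe, hbcol' y hy hyρ, P.j₁.left_inv (by rw [hZ₁src]; exact hψZ₁ y hy)]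
  have hb₁_mem : ∀ y : EuclideanSpace ℝ (Fin 4), ‖y‖ < ρ → b₁ y ∈ P.Z₁ := fun y hy ↦ by
    rw [← hZ₁src, ← OpenPartialHomeomorph.symm_target]
    exact P.j₁.symm.map_source (hbρ_sub y hy)
  have hb₁_left : ∀ y : EuclideanSpace ℝ (Fin 4), ‖y‖ < ρ → b₁.symm (b₁ y) = y := fun y hy ↦
    b₁.left_inv (hb₁src (mem_ball_zero_iff.2 hy))
  have hb₁_injOn : InjOn b₁ (ball 0 ρ) := b₁.injOn.mono hb₁src
  /- S7: the glued diffeomorphism `X₀ ≅ X₁` -/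
  set A : Set X₀ := c₀ '' closedBall 0 1 with hA
  set B : Set X₁ := b₁ '' closedBall 0 1 with hB
  have hA_closed : IsClosed A :=
    ((isCompact_closedBall (0 : EuclideanSpace ℝ (Fin 4)) 1).image_of_continuousOn
      (c₀.continuousOn.mono (by rw [hc₀src]; exact subset_univ _))).isClosed
  have hB_closed : IsClosed B :=
    ((isCompact_closedBall (0 : EuclideanSpace ℝ (Fin 4)) 1).image_of_continuousOn
      (b₁.continuousOn.mono ((closedBall_subset_ball hρ).trans hb₁src))).isClosed
  have hK₀A : P.K₀ ⊆ A := fun k hk ↦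
    ⟨c₀.symm k, mem_closedBall_zero_iff.2 (by linarith [hc₀K k hk]), hc₀_right k (P.K₀_subset hk)⟩
  have hmemA : ∀ y : EuclideanSpace ℝ (Fin 4), c₀ y ∈ A ↔ ‖y‖ ≤ 1 := fun y ↦
    ⟨fun ⟨y', hy', hyy'⟩ ↦ by rw [← hc₀_inj hyy']; exact mem_closedBall_zero_iff.1 hy',
      fun hy ↦ ⟨y, mem_closedBall_zero_iff.2 hy, rfl⟩⟩
  have hmemB : ∀ y : EuclideanSpace ℝ (Fin 4), ‖y‖ < ρ → (b₁ y ∈ B ↔ ‖y‖ ≤ 1) := fun y hyρ ↦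
    ⟨fun ⟨y', hy', hyy'⟩ ↦ by
        have : y' = y := hb₁_injOn (closedBall_subset_ball hρ hy') (mem_ball_zero_iff.2 hyρ) hyy'
        rw [← this]; exact mem_closedBall_zero_iff.1 hy',
      fun hy ↦ ⟨y, mem_closedBall_zero_iff.2 hy, rfl⟩⟩
  have hK₁B : P.K₁ ⊆ B := by
    intro k hk
    have hkZ : k ∈ P.Z₁ := P.K₁_subset hk
    have hjk : P.j₁ k ∈ b '' closedBall 0 1 := by
      rw [hbimg]
      rintro ⟨q, hq, hqk⟩
      have hqs : q ∈ P.Ψ.source := hcompl_src hq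
      have : P.Ψ q ∈ P.Ψ.target := P.Ψ.map_source hqs
      rw [P.Ψ_target, hqk] at this
      exact this ⟨k, hk, rfl⟩
    obtain ⟨y, hy, hyk⟩ := hjk
    refine ⟨y, hy, ?_⟩
    rw [hb₁coe, hyk, P.j₁.left_inv (by rw [hZ₁src]; exact hkZ)]
  -- the map `F : X₀ → X₁`
  set F : X₀ → X₁ := fun x ↦ if x ∈ A then b₁ (c₀.symm x) else P.ψ x with hF
  set W : Set X₀ := c₀ '' ball 0 ρ with hW
  have hW_open : IsOpen W :=
    c₀.isOpen_image_of_subset_source isOpen_ball (by rw [hc₀src]; exact subset_univ _)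
  have hAW : A ⊆ W := image_mono (closedBall_subset_ball hρ)
  have hWZ₀ : W ⊆ P.Z₀ := by rintro _ ⟨y, -, rfl⟩; exact hc₀_mem y
  have hF_W : EqOn F (b₁ ∘ c₀.symm) W := by
    rintro _ ⟨y, hy, rfl⟩
    have hyρ := mem_ball_zero_iff.1 hy
    by_cases hy1 : ‖y‖ ≤ 1
    · exact if_pos ((hmemA y).2 hy1)
    · push Not at hy1
      have hnA : c₀ y ∉ A := fun h ↦ absurd ((hmemA y).1 h) (not_le.2 hy1)
      show (if c₀ y ∈ A then b₁ (c₀.symm (c₀ y)) else P.ψ (c₀ y)) = b₁ (c₀.symm (c₀ y))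
      rw [if_neg hnA, hc₀_left, hb₁col y hy1.le hyρ]
  have hF_Ac : EqOn F P.ψ Aᶜ := fun x hx ↦ if_neg hx
  have hF_smooth : ContMDiff (𝓡 4) (𝓡 4) ∞ F := by
    intro x
    by_cases hx : x ∈ W
    · have h1 : ContMDiffOn (𝓡 4) (𝓡 4) ∞ (b₁ ∘ c₀.symm) W := by
        refine hb₁c.comp (hc₀c'.mono (by rw [hc₀tgt]; exact hWZ₀)) ?_
        rintro _ ⟨y, hy, rfl⟩
        show c₀.symm (c₀ y) ∈ b₁.source
        rw [hc₀_left]; exact hb₁src hy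
      exact (h1.congr hF_W).contMDiffAt (hW_open.mem_nhds hx)
    · have hxA : x ∉ A := fun h ↦ hx (hAW h)
      have h2 : ContMDiffOn (𝓡 4) (𝓡 4) ∞ P.ψ Aᶜ :=
        P.contMDiffOn_ψ.mono (by rw [P.ψ_source]; exact compl_subset_compl.2 hK₀A)
      exact (h2.congr hF_Ac).contMDiffAt (hA_closed.isOpen_compl.mem_nhds hxA)
  -- the map `G : X₁ → X₀`
  set G : X₁ → X₀ := fun z ↦ if z ∈ B then c₀ (b₁.symm z) else P.ψ.symm z with hG
  set W₁ : Set X₁ := b₁ '' ball 0 ρ with hW₁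
  have hW₁_open : IsOpen W₁ := b₁.isOpen_image_of_subset_source isOpen_ball hb₁src
  have hBW₁ : B ⊆ W₁ := image_mono (closedBall_subset_ball hρ)
  have hG_W₁ : EqOn G (c₀ ∘ b₁.symm) W₁ := by
    rintro _ ⟨y, hy, rfl⟩
    have hyρ := mem_ball_zero_iff.1 hy
    by_cases hy1 : ‖y‖ ≤ 1
    · exact if_pos ((hmemB y hyρ).2 hy1)
    · push Not at hy1
      have hnB : b₁ y ∉ B := fun h ↦ absurd ((hmemB y hyρ).1 h) (not_le.2 hy1)
      show (if b₁ y ∈ B then c₀ (b₁.symm (b₁ y)) else P.ψ.symm (b₁ y)) = c₀ (b₁.symm (b₁ y))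
      rw [if_neg hnB, hb₁_left y hyρ, hb₁col y hy1.le hyρ, P.ψ.left_inv (hψsrc y hy1.le)]
  have hG_Bc : EqOn G P.ψ.symm Bᶜ := fun z hz ↦ if_neg hz
  have hG_smooth : ContMDiff (𝓡 4) (𝓡 4) ∞ G := by
    intro z
    by_cases hz : z ∈ W₁
    · have h1 : ContMDiffOn (𝓡 4) (𝓡 4) ∞ (c₀ ∘ b₁.symm) W₁ := by
        refine (hc₀c.mono hc₀src.ge).comp (hb₁c'.mono ?_) ?_
        · rintro _ ⟨y, hy, rfl⟩; exact b₁.map_source (hb₁src hy)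
        · exact fun _ _ ↦ mem_univ _
      exact (h1.congr hG_W₁).contMDiffAt (hW₁_open.mem_nhds hz)
    · have hzB : z ∉ B := fun h ↦ hz (hBW₁ h)
      have h2 : ContMDiffOn (𝓡 4) (𝓡 4) ∞ P.ψ.symm Bᶜ :=
        P.contMDiffOn_ψ_symm.mono (by rw [P.ψ_target]; exact compl_subset_compl.2 hK₁B)
      exact (h2.congr hG_Bc).contMDiffAt (hB_closed.isOpen_compl.mem_nhds hzB)
  -- `G ∘ F = id`
  have hGF : ∀ x, G (F x) = x := by
    intro x
    by_cases hxA : x ∈ A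
    · obtain ⟨y, hy, rfl⟩ := hxA
      have hy1 := mem_closedBall_zero_iff.1 hy
      have hyρ : ‖y‖ < ρ := by linarith
      have hFx : F (c₀ y) = b₁ y := by
        rw [hF_W (hAW ⟨y, hy, rfl⟩)]
        show b₁ (c₀.symm (c₀ y)) = b₁ y
        rw [hc₀_left]
      rw [hFx, hG_W₁ ⟨y, mem_ball_zero_iff.2 hyρ, rfl⟩]
      show c₀ (b₁.symm (b₁ y)) = c₀ y
      rw [hb₁_left y hyρ]
    · have hFx : F x = P.ψ x := hF_Ac hxA
      have hxs : x ∈ P.ψ.source := by rw [P.ψ_source]; exact fun h ↦ hxA (hK₀A h)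
      have hnotB : P.ψ x ∉ B := by
        rintro ⟨y, hy, hyx⟩
        have hy1 := mem_closedBall_zero_iff.1 hy
        have hyρ : ‖y‖ < ρ := by linarith
        have hψZ : P.ψ x ∈ P.Z₁ := by rw [← hyx]; exact hb₁_mem y hyρ
        have hxZ : x ∈ P.Z₀ := (P.apply_mem_iff x hxs).1 hψZ
        have hx' : c₀ (c₀.symm x) = x := hc₀_right x hxZ
        have hy₀ : 1 < ‖c₀.symm x‖ := by
          by_contra h
          push Not at h
          exact hxA (hx' ▸ (hmemA _).2 h)
        have hxK : x ∉ P.K₀ := fun h ↦ hxA (hK₀A h)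
        have hI : P.j₁ (P.ψ x) ∈ b '' closedBall 0 1 :=
          ⟨y, hy, by rw [← hyx, hb₁coe, P.j₁.right_inv (hbρ_sub y hyρ)]⟩
        rw [hbimg] at hI
        apply hI
        refine ⟨e (c₀.symm x), ?_, ?_⟩
        · rintro ⟨y', hy', hyy⟩
          have : y' = c₀.symm x :=
            e.injOn (by rw [hesrc]; trivial) (by rw [hesrc]; trivial) hyy
          rw [this, mem_closedBall_zero_iff] at hy'
          linarith
        · rw [hecoe, hx', P.apply_j₀ x ⟨hxZ, hxK⟩]
      rw [hFx, hG_Bc hnotB, P.ψ.left_inv hxs]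
  -- `F ∘ G = id`
  have hFG : ∀ z, F (G z) = z := by
    intro z
    by_cases hzB : z ∈ B
    · obtain ⟨y, hy, rfl⟩ := hzB
      have hy1 := mem_closedBall_zero_iff.1 hy
      have hyρ : ‖y‖ < ρ := by linarith
      have hGz : G (b₁ y) = c₀ y := by
        rw [hG_W₁ (hBW₁ ⟨y, hy, rfl⟩)]
        show c₀ (b₁.symm (b₁ y)) = c₀ y
        rw [hb₁_left y hyρ]
      rw [hGz, hF_W (hAW ⟨y, hy, rfl⟩)]
      show b₁ (c₀.symm (c₀ y)) = b₁ y
      rw [hc₀_left]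
    · have hGz : G z = P.ψ.symm z := hG_Bc hzB
      have hzt : z ∈ P.ψ.target := by rw [P.ψ_target]; exact fun h ↦ hzB (hK₁B h)
      have hxs : P.ψ.symm z ∈ P.ψ.source := P.ψ.map_target hzt
      have hψx : P.ψ (P.ψ.symm z) = z := P.ψ.right_inv hzt
      have hxK : P.ψ.symm z ∉ P.K₀ := by rw [P.ψ_source] at hxs; exact hxs
      have hxA : P.ψ.symm z ∉ A := by
        rintro ⟨y, hy, hyx⟩
        have hxZ : P.ψ.symm z ∈ P.Z₀ := by rw [← hyx]; exact hc₀_mem y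
        have hzZ : z ∈ P.Z₁ := by rw [← hψx]; exact (P.apply_mem_iff _ hxs).2 hxZ
        have hj : P.j₁ z = P.Ψ (e y) := by
          conv_lhs => rw [← hψx]
          rw [← P.apply_j₀ _ ⟨hxZ, hxK⟩, hecoe, hyx]
        have hes : e y ∈ P.Ψ.source := by
          rw [P.Ψ_source]
          rintro ⟨k, hk, hke⟩
          have : k = P.ψ.symm z :=
            P.j₀.injOn (by rw [hZ₀src]; exact P.K₀_subset hk) (by rw [hZ₀src]; exact hxZ)
              (by rw [hke, hecoe, hyx])
          exact hxK (this ▸ hk)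
        have hI : P.j₁ z ∈ b '' closedBall 0 1 := by
          rw [hbimg]
          rintro ⟨q, hq, hqz⟩
          have hqs := hcompl_src hq
          have : q = e y := P.Ψ.injOn hqs hes (by rw [hqz, hj])
          exact hq (this ▸ ⟨y, hy, rfl⟩)
        obtain ⟨y', hy', hyz⟩ := hI
        exact hzB ⟨y', hy', by rw [hb₁coe, hyz, P.j₁.left_inv (by rw [hZ₁src]; exact hzZ)]⟩
      rw [hGz, hF_Ac hxA, hψx]
  exact ⟨⟨⟨F, G, hGF, hFG⟩, hF_smooth, hG_smooth⟩⟩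

/-- **A small exotic `ℝ⁴` exists, from the end data of one non-diffeomorphic pair** (Kirby
1989, Ch. XIV, Thm. 3 "There exists an exotic `ℝ⁴_Θ` which imbeds smoothly in `S⁴`", proof
pp. 98–101, where the pair is `X₀ = L(2,3)`, `X₁ = CP² ♯ 9(−CP²)`, "not diffeomorphic" by
Donaldson, and the end data is that of the partial smooth product structure of the h-cobordism
`Y` between them): the tree's spc4.S11 (Mathlib's
`proof_wanted exists_open_nonempty_homeomorph_isEmpty_diffeomorph_euclideanSpace_four`) follows
from the end data `P : PartialProductEnds X₀ X₁` of any pair of 4-manifolds that are NOT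
diffeomorphic. For if every open `ℝ⁴`-homeomorph in `ℝ⁴` were diffeomorphic to `ℝ⁴`, the pair
would be diffeomorphic by `PartialProductEnds.nonempty_diffeomorph`. This unbundled form is the
hypothesis shape Kirby prints (one pair): in the source `P` is the Casson–Freedman analysis of
Donaldson's h-cobordism (pp. 99–101; not vendored as a named fact, see the module docstring)
and `hE` is Donaldson's theorem (p. 98; abstractly the tree's fact spc4.S16,
`exists_isHCobordant_isEmpty_diffeomorph_four`). [cite: Kirby1989, Ch. XIV Thm. 3 (proof pp. 98-101)] -/
theorem PartialProductEnds.exists_opens_nonempty_homeomorph_isEmpty_diffeomorph_euclideanSpace_four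
    (P : PartialProductEnds X₀ X₁) (hE : IsEmpty (X₀ ≃ₘ⟮𝓡 4, 𝓡 4⟯ X₁)) :
    exists_opens_nonempty_homeomorph_isEmpty_diffeomorph_euclideanSpace_four := by
  by_contra h
  have hU : ∀ U : TopologicalSpace.Opens (EuclideanSpace ℝ (Fin 4)), Nonempty (U ≃ₜ EuclideanSpace ℝ (Fin 4)) →
      Nonempty (U ≃ₘ⟮𝓡 4, 𝓡 4⟯ EuclideanSpace ℝ (Fin 4)) := by
    intro U hU'
    by_contra hne
    exact h ⟨U, hU', ⟨fun d ↦ hne ⟨d⟩⟩⟩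
  obtain ⟨d⟩ := P.nonempty_diffeomorph hU
  exact hE.false d

end Bridge

end Literature.Topology.FourManifolds

end
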